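import Literature.Analysis.FunctionSpaces.AubinLionsSlices
import Literature.Analysis.FunctionSpaces.DiagonalWeakLimits
import HarnessLib

/-!
# Extraction of slice-wise convergent subsequences from equicontinuous pairings, and the
Aubin–Lions compactness theorem for sequences with equicontinuous pairings

Analysis/FunctionSpaces theorem file (no definitions, no named facts); sequel of
`AubinLionsSlices`. In every compactness construction of weak solutions of an evolution equation
on a cylinder `I × Ω` one first obtains, from the equation, a bound on `∂ₜ v_k` in a weak norm —
concretely: the pairings `t ↦ ∫_Ω φ • v_k(t)` with test functions `φ` are equicontinuous in `t`,
uniformly in `k` (up to the null set of times where the slices are not defined) — and then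
extracts, by Arzelà–Ascoli / Cantor's diagonal procedure, a subsequence whose pairings converge
for every (a.e.) time (Leray 1934, §13 and §28; Hopf 1951, §4; Temam, *Navier–Stokes equations*
(1977/79), Ch. III, proof of Thm. 3.1 with Thm. 2.1; Ożański–Pooley 2018, proof of Thm. 6.37,
Step 1; Lemarié-Rieusset 2016, Thm. 12.1–12.2). This file provides that step abstractly and
combines it with the strong compactness theorem of `AubinLionsSlices`:

* `AubinLions.exists_subseq_ae_tendsto_of_equicontinuous` — countably many families
  `g_k^j : I → F` (`F` proper), a.e. bounded by `M_j` and **equicontinuous on a full-measure set**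
  with a modulus `ω_j` independent of `k`, admit one subsequence `σ` along which `g_{σ i}^j(t)`
  converges for a.e. `t`, for every `j` (diagonal extraction on a countable dense set of good
  times, `exists_strictMono_forall_tendsto`, and `ε/3`, `forall_exists_tendsto_of_subset_closure`);
* `AubinLions.ae_tendsto_pairing_of_dense` — for fields with `∫_Ω ‖v_k(t)‖² ≤ C`, a.e.
  convergence of the pairings with an `L²(Ω)`-dense sequence of test functions
  (`exists_seq_isTestFunctionOn_dense`) upgrades to every test function;
* `AubinLions.exists_subseq_strong_limit_of_equicontinuous` — **Aubin–Lions for sequences with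
  equicontinuous pairings**: fields `v_k` on `I × Ω` (`Ω` a bounded Lipschitz domain) bounded in
  `L^∞_t L²_x`, with slice-wise weak derivatives bounded in `L²_{t,x}`, whose pairings with every
  test function are equicontinuous in time on a full-measure set uniformly in `k`, have a
  subsequence converging **strongly in `L²(I × Ω)`** (and slice-wise in `𝓓'(Ω)` for a.e. `t`) to a
  jointly measurable `u` with `∫_Ω ‖u(t)‖² ≤ C` (Temam 1977/79, Ch. III, Thm. 2.1;
  Lemarié-Rieusset 2016, Thm. 12.1 "Rellich–Lions").

## Mathlib / tree search

Mathlib (this pin): `Metric.tendsto_nhds_nhds`, `TopologicalSpace.IsSeparable`,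
`cauchySeq_tendsto_of_complete`; no Arzelà–Ascoli "up to null sets" and no Aubin–Lions theorem.
Tree: `exists_strictMono_forall_tendsto`, `forall_exists_tendsto_of_subset_closure`
(`DiagonalWeakLimits`, Leray's Step 1 on the whole space), `exists_seq_isTestFunctionOn_dense`,
`Ehrling.enorm_integral_smul_le` (`EhrlingLemma`), `AubinLions.exists_strong_limit`
(`AubinLionsSlices`).

## References

* R. Temam, *Navier–Stokes equations. Theory and numerical analysis* (North-Holland, 1977;
  rev. ed. 1979), Ch. III, §2 Thm. 2.1, §3 proof of Thm. 3.1. [Temam1979]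
* P. G. Lemarié-Rieusset, *The Navier–Stokes problem in the 21st century* (CRC, 2016), §12.1,
  Thm. 12.1 (Rellich–Lions), p. 355. [Lemarierieusset2016]
* W. S. Ożański, B. C. Pooley, *Leray's fundamental work on the Navier–Stokes equations*
  (2018), proof of Thm. 6.37, Step 1. [OzanskiPooley2018]
* J. Leray, Acta Math. 63 (1934), §13 (procédé diagonal).
-/

noncomputable section

open MeasureTheory TopologicalSpace Set Function Filter Topology Metric Bornology
open scoped ENNReal NNReal

namespace Literature.Analysis.FunctionSpaces

/-! ### Abstract extraction: equicontinuity up to null sets -/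

section Abstract

variable {F : Type*} [NormedAddCommGroup F] [ProperSpace F]

/-- **A common convergent subsequence for countably many a.e.-equicontinuous bounded families.**
Let `g k j : ℝ → F` (`k, j ∈ ℕ`, `F` a proper normed group, e.g. finite-dimensional) satisfy, with
respect to a measure `volume.restrict I`: `‖g k j t‖ ≤ M j` for a.e. `t`, and for every `k, j` a
full-measure set `S` with `‖g k j t - g k j s‖ ≤ ω j (t - s)` for `t, s ∈ S`, where the moduli
`ω j` (independent of `k`) tend to `0` at `0`. Then along one subsequence `σ`, for every `j`,
`g (σ i) j t` converges for a.e. `t` (Cantor's diagonal procedure on a countable dense set of good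
times, then `ε/3`: Leray 1934, §13; Ożański–Pooley 2018, proof of Thm. 6.37, Step 1; Temam
1977/79, Ch. III, §3). [cite: OzanskiPooley2018, proof of Thm. 6.37 Step 1] -/
theorem AubinLions.exists_subseq_ae_tendsto_of_equicontinuous {I : Set ℝ}
    {g : ℕ → ℕ → ℝ → F} {M : ℕ → ℝ} {ω : ℕ → ℝ → ℝ}
    (hω : ∀ j, Tendsto (ω j) (𝓝 0) (𝓝 0))
    (hB : ∀ k j, ∀ᵐ t ∂(volume.restrict I), ‖g k j t‖ ≤ M j)
    (hEC : ∀ k j, ∃ S : Set ℝ, (∀ᵐ t ∂(volume.restrict I), t ∈ S) ∧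
      ∀ t ∈ S, ∀ s ∈ S, ‖g k j t - g k j s‖ ≤ ω j (t - s)) :
    ∃ σ : ℕ → ℕ, StrictMono σ ∧ ∀ j, ∀ᵐ t ∂(volume.restrict I),
      ∃ l, Tendsto (fun i => g (σ i) j t) atTop (𝓝 l) := by
  choose S hSae hS using hEC
  -- the common set of good times
  set T : Set ℝ := {t | ∀ k j, t ∈ S k j ∧ ‖g k j t‖ ≤ M j} with hT
  have hTae : ∀ᵐ t ∂(volume.restrict I), t ∈ T := by
    have h : ∀ᵐ t ∂(volume.restrict I), ∀ k j, t ∈ S k j ∧ ‖g k j t‖ ≤ M j :=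
      ae_all_iff.2 fun k => ae_all_iff.2 fun j => (hSae k j).and (hB k j)
    exact h
  -- a countable dense subset of `T`
  obtain ⟨D, hDT, hDc, hTD⟩ := (IsSeparable.of_separableSpace T).exists_countable_dense_subset
  haveI : Countable D := hDc.to_subtype
  -- diagonal extraction at the points of `D`
  obtain ⟨σ, hσ, hconv⟩ := exists_strictMono_forall_tendsto (ι := D × ℕ)
    (fun k (p : D × ℕ) => g k p.2 (p.1 : ℝ)) fun p => ⟨0, M p.2, fun n => by
      simpa [mem_closedBall, dist_zero_right] using ((hDT p.1.2) n p.2).2⟩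
  refine ⟨σ, hσ, fun j => ?_⟩
  filter_upwards [hTae] with t ht
  refine forall_exists_tendsto_of_subset_closure (x := fun n s => g (σ n) j s) hTD
    (fun d hd => hconv (⟨d, hd⟩, j)) (fun ε hε => ?_) t ht
  obtain ⟨δ, hδ, hδω⟩ := Metric.tendsto_nhds_nhds.1 (hω j) ε hε
  refine ⟨δ, hδ, fun n s hs d hd hsd => ?_⟩
  have h1 := hS (σ n) j s (hs (σ n) j).1 d ((hDT hd) (σ n) j).1
  have h2 : ‖ω j (s - d)‖ < ε := by
    have := hδω (x := s - d) (by simpa [Real.dist_eq] using hsd)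
    simpa [Real.dist_eq] using this
  calc dist (g (σ n) j s) (g (σ n) j d) = ‖g (σ n) j s - g (σ n) j d‖ := dist_eq_norm _ _
    _ ≤ ω j (s - d) := h1
    _ ≤ ‖ω j (s - d)‖ := Real.le_norm_self _
    _ < ε := h2

end Abstract

/-! ### Pairings of space–time fields: density upgrade and the packaged compactness theorem -/

section Pairings

variable {E' : Type*} [NormedAddCommGroup E'] [InnerProductSpace ℝ E'] [FiniteDimensional ℝ E']
  [MeasureSpace E'] [BorelSpace E'] [(volume : Measure E').IsAddHaarMeasure]
variable {F : Type*} [NormedAddCommGroup F] [NormedSpace ℝ F] [FiniteDimensional ℝ F]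

omit [FiniteDimensional ℝ F] in
/-- **From a dense sequence of test functions to all test functions.** If the fields `v_k` on
`I × Ω` (`Ω` bounded) satisfy `∫_Ω ‖v_k(t)‖² ≤ C` for a.e. `t` and their slice pairings with the
members `dⱼ` of an `L²(Ω)`-dense sequence of test functions converge for a.e. `t`, then so do
the pairings with every real test function on `Ω` (the pairings with `φ` and with a nearby `dⱼ`
differ by at most `‖φ - dⱼ‖₂ C^{1/2}`, uniformly in `k`; `ε/3`). [folklore] -/
theorem AubinLions.ae_tendsto_pairing_of_dense [CompleteSpace F] {Ω : Opens E'}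
    (hbΩ : IsBounded (Ω : Set E')) {a b : ℝ} {v : ℕ → ℝ → E' → F} {C : ℝ≥0∞} (hC : C ≠ ⊤)
    (hvm : ∀ k, AEStronglyMeasurable (uncurry (v k)) (volume.restrict (Ioo a b ×ˢ (Ω : Set E'))))
    (hvE : ∀ k, ∀ᵐ t ∂(volume.restrict (Ioo a b)), ∫⁻ x in (Ω : Set E'), ‖v k t x‖ₑ ^ 2 ≤ C)
    {d : ℕ → E' → ℝ} (hd : ∀ j, IsTestFunctionOn Ω (d j))
    (hdense : ∀ g : E' → ℝ, IsTestFunctionOn Ω g → ∀ ε : ℝ≥0∞, ε ≠ 0 →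
      ∃ j, eLpNorm (g - d j) 2 (volume.restrict (Ω : Set E')) < ε)
    (hconv : ∀ j, ∀ᵐ t ∂(volume.restrict (Ioo a b)),
      ∃ l, Tendsto (fun k => ∫ x in (Ω : Set E'), d j x • v k t x) atTop (𝓝 l)) :
    ∀ φ : E' → ℝ, IsTestFunctionOn Ω φ → ∃ L : ℝ → F, ∀ᵐ t ∂(volume.restrict (Ioo a b)),
      Tendsto (fun k => ∫ x in (Ω : Set E'), φ x • v k t x) atTop (𝓝 (L t)) := by
  haveI : IsFiniteMeasure ((volume : Measure E').restrict (Ω : Set E')) := ⟨by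
    rw [Measure.restrict_apply_univ]
    exact (measure_mono subset_closure).trans_lt hbΩ.isCompact_closure.measure_lt_top⟩
  intro φ hφ
  -- it suffices to show a.e. convergence to some limit
  suffices h : ∀ᵐ t ∂(volume.restrict (Ioo a b)),
      ∃ l, Tendsto (fun k => ∫ x in (Ω : Set E'), φ x • v k t x) atTop (𝓝 l) by
    refine ⟨fun t => limUnder atTop fun k => ∫ x in (Ω : Set E'), φ x • v k t x, ?_⟩
    filter_upwards [h] with t ht
    exact tendsto_nhds_limUnder ht
  have hvs : ∀ᵐ t ∂(volume.restrict (Ioo a b)), ∀ k,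
      AEStronglyMeasurable (v k t) (volume.restrict (Ω : Set E')) :=
    ae_all_iff.2 fun k => AubinLions.ae_aestronglyMeasurable_slice (hvm k)
  have hvEall : ∀ᵐ t ∂(volume.restrict (Ioo a b)), ∀ k,
      ∫⁻ x in (Ω : Set E'), ‖v k t x‖ₑ ^ 2 ≤ C := ae_all_iff.2 hvE
  have hconv' : ∀ᵐ t ∂(volume.restrict (Ioo a b)), ∀ j,
      ∃ l, Tendsto (fun k => ∫ x in (Ω : Set E'), d j x • v k t x) atTop (𝓝 l) :=
    ae_all_iff.2 hconv
  filter_upwards [hvs, hvEall, hconv'] with t hvt hEt hct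
  -- square integrability of the slices and the bound on the pairing error
  have hmv : ∀ k, MemLp (v k t) 2 (volume.restrict (Ω : Set E')) := fun k => by
    refine ⟨hvt k, ?_⟩
    rw [AubinLions.eLpNorm_two_eq_rpow]
    exact ENNReal.rpow_lt_top_of_nonneg (by norm_num) ((hEt k).trans_lt hC.lt_top).ne
  have hvn : ∀ k, eLpNorm (v k t) 2 (volume.restrict (Ω : Set E')) ≤ C ^ (1 / 2 : ℝ) := fun k => by
    rw [AubinLions.eLpNorm_two_eq_rpow]
    exact ENNReal.rpow_le_rpow (hEt k) (by norm_num)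
  have herr : ∀ j k, ‖(∫ x in (Ω : Set E'), φ x • v k t x) - ∫ x in (Ω : Set E'), d j x • v k t x‖ₑ ≤
      eLpNorm (φ - d j) 2 (volume.restrict (Ω : Set E')) * C ^ (1 / 2 : ℝ) := by
    intro j k
    rw [← integral_sub (Ehrling.integrable_smul_of_memLp_two hφ (hmv k))
      (Ehrling.integrable_smul_of_memLp_two (hd j) (hmv k))]
    have e : (fun x => φ x • v k t x - d j x • v k t x) = fun x => (φ - d j) x • v k t x := by
      funext x; simp only [Pi.sub_apply, sub_smul]
    rw [e]
    exact (Ehrling.enorm_integral_smul_le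
      ((hφ.contDiff.continuous.sub (hd j).contDiff.continuous).aestronglyMeasurable) (hvt k)).trans
      (mul_le_mul' le_rfl (hvn k))
  -- Cauchy criterion, `ε / 3`
  refine cauchySeq_tendsto_of_complete (Metric.cauchySeq_iff.2 fun ε hε => ?_)
  have hC2 : C ^ (1 / 2 : ℝ) ≠ ⊤ := (ENNReal.rpow_lt_top_of_nonneg (by norm_num) hC).ne
  have hε3 : ENNReal.ofReal (ε / 3) ≠ 0 := by
    rw [← pos_iff_ne_zero, ENNReal.ofReal_pos]; positivity
  obtain ⟨η, hη, hηC⟩ := ENNReal.exists_nnreal_pos_mul_lt hC2 hε3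
  obtain ⟨j, hj⟩ := hdense φ hφ η (by exact_mod_cast hη.ne')
  have herr' : ∀ k, ‖(∫ x in (Ω : Set E'), φ x • v k t x) - ∫ x in (Ω : Set E'), d j x • v k t x‖ <
      ε / 3 := by
    intro k
    rw [← toReal_enorm]
    refine ENNReal.toReal_lt_of_lt_ofReal ((herr j k).trans_lt ?_)
    exact (mul_le_mul' hj.le le_rfl).trans_lt hηC
  obtain ⟨l, hl⟩ := hct j
  obtain ⟨N, hN⟩ := Metric.cauchySeq_iff.1 hl.cauchySeq (ε / 3) (by positivity)
  refine ⟨N, fun m hm n hn => ?_⟩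
  calc dist (∫ x in (Ω : Set E'), φ x • v m t x) (∫ x in (Ω : Set E'), φ x • v n t x)
      ≤ dist (∫ x in (Ω : Set E'), φ x • v m t x) (∫ x in (Ω : Set E'), d j x • v m t x) +
        dist (∫ x in (Ω : Set E'), d j x • v m t x) (∫ x in (Ω : Set E'), d j x • v n t x) +
        dist (∫ x in (Ω : Set E'), d j x • v n t x) (∫ x in (Ω : Set E'), φ x • v n t x) :=
        dist_triangle4 _ _ _ _
    _ < ε / 3 + ε / 3 + ε / 3 := by
        refine add_lt_add (add_lt_add ?_ (hN m hm n hn)) ?_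
        · rw [dist_eq_norm]; exact herr' m
        · rw [dist_comm, dist_eq_norm]; exact herr' n
    _ = ε := by ring

/-- **Aubin–Lions compactness for sequences with equicontinuous pairings.** Let `Ω` be a bounded
Lipschitz domain of a finite-dimensional real inner product space (Lebesgue measure), `I = (a, b)`,
`F` finite-dimensional, and `v_k : I × Ω → F` jointly measurable fields with
* `∫_Ω ‖v_k(t)‖² ≤ C` for a.e. `t ∈ I` (bounded in `L^∞_t L²_x`);
* slice-wise weak derivatives `G_k(t)` on `Ω` for a.e. `t`, jointly measurable, with
  `∫_I∫_Ω ‖G_k‖² ≤ C_g` (bounded in `L²_t H¹_x`);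
* for every real test function `φ` on `Ω`, a modulus `ω` with `ω(δ) → 0` as `δ → 0` such that for
  every `k` the pairing `t ↦ ∫_Ω φ • v_k(t)` satisfies `‖∫_Ω φ • v_k(t) - ∫_Ω φ • v_k(s)‖ ≤ ω(t - s)`
  for all `t, s` in a full-measure subset of `I` (equicontinuity in time up to null sets,
  uniformly in `k` — in the applications a consequence of the equation).
Then a subsequence `v_{σ i}` converges **strongly in `L²(I × Ω)`** to a jointly measurable field
`u` with `∫_Ω ‖u(t)‖² ≤ C` for a.e. `t`, and its slice pairings converge to those of `u` for a.e.
`t` (R. Temam, *Navier–Stokes equations*, Ch. III, Thm. 2.1 (compactness in `L²(0,T;L²)` from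
bounds in `L²(0,T;H¹)` and on time derivatives) as used in the proof of Thm. 3.1;
Lemarié-Rieusset 2016, Thm. 12.1 "Rellich–Lions"; Hopf 1951, §4; Lions 1969, Ch. 1, Thm. 5.1).
Assembled from `AubinLions.exists_subseq_ae_tendsto_of_equicontinuous` (extraction),
`AubinLions.ae_tendsto_pairing_of_dense` (density) and `AubinLions.exists_strong_limit`
(Ehrling + completeness). [cite: Temam1979, Ch. III §2 Thm. 2.1] [cite: Lemarierieusset2016, Thm. 12.1 (Rellich–Lions)] -/
theorem AubinLions.exists_subseq_strong_limit_of_equicontinuous {Ω : Opens E'}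
    (hΩ : IsLipschitzDomain Ω) (hbΩ : IsBounded (Ω : Set E')) {a b : ℝ}
    {v : ℕ → ℝ → E' → F} {G : ℕ → ℝ → E' → E' →L[ℝ] F} {C Cg : ℝ≥0∞}
    (hC : C ≠ ⊤) (hCg : Cg ≠ ⊤)
    (hvm : ∀ k, AEStronglyMeasurable (uncurry (v k)) (volume.restrict (Ioo a b ×ˢ (Ω : Set E'))))
    (hvE : ∀ k, ∀ᵐ t ∂(volume.restrict (Ioo a b)), ∫⁻ x in (Ω : Set E'), ‖v k t x‖ₑ ^ 2 ≤ C)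
    (hGm : ∀ k, AEStronglyMeasurable (uncurry (G k)) (volume.restrict (Ioo a b ×ˢ (Ω : Set E'))))
    (hG : ∀ k, ∀ᵐ t ∂(volume.restrict (Ioo a b)), HasWeakFDerivOn Ω volume (v k t) (G k t))
    (hGb : ∀ k, ∫⁻ z in Ioo a b ×ˢ (Ω : Set E'), ‖G k z.1 z.2‖ₑ ^ 2 ≤ Cg)
    (hEC : ∀ φ : E' → ℝ, IsTestFunctionOn Ω φ → ∃ ω : ℝ → ℝ, Tendsto ω (𝓝 0) (𝓝 0) ∧
      ∀ k, ∃ S : Set ℝ, (∀ᵐ t ∂(volume.restrict (Ioo a b)), t ∈ S) ∧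
        ∀ t ∈ S, ∀ s ∈ S, ‖(∫ x in (Ω : Set E'), φ x • v k t x) -
          ∫ x in (Ω : Set E'), φ x • v k s x‖ ≤ ω (t - s)) :
    ∃ (σ : ℕ → ℕ) (u : ℝ → E' → F), StrictMono σ ∧
      AEStronglyMeasurable (uncurry u) (volume.restrict (Ioo a b ×ˢ (Ω : Set E'))) ∧
      (∀ᵐ t ∂(volume.restrict (Ioo a b)), ∫⁻ x in (Ω : Set E'), ‖u t x‖ₑ ^ 2 ≤ C) ∧
      Tendsto (fun i => ∫⁻ z in Ioo a b ×ˢ (Ω : Set E'), ‖v (σ i) z.1 z.2 - u z.1 z.2‖ₑ ^ 2)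
        atTop (𝓝 0) ∧
      ∀ φ : E' → ℝ, IsTestFunctionOn Ω φ → ∀ᵐ t ∂(volume.restrict (Ioo a b)),
        Tendsto (fun i => ∫ x in (Ω : Set E'), φ x • v (σ i) t x) atTop
          (𝓝 (∫ x in (Ω : Set E'), φ x • u t x)) := by
  haveI : CompleteSpace F := FiniteDimensional.complete ℝ F
  haveI : ProperSpace F := FiniteDimensional.proper ℝ F
  -- the dense sequence of test functions and the pairings `g k j t = ∫_Ω dⱼ • v_k(t)`
  obtain ⟨d, hd, hdense⟩ := exists_seq_isTestFunctionOn_dense Ω (volume : Measure E')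
  choose ω hω S hSae hS using fun j => hEC (d j) (hd j)
  -- a.e. bound of the pairings
  have hvs : ∀ k, ∀ᵐ t ∂(volume.restrict (Ioo a b)),
      AEStronglyMeasurable (v k t) (volume.restrict (Ω : Set E')) := fun k =>
    AubinLions.ae_aestronglyMeasurable_slice (hvm k)
  have hKt : ∀ j, eLpNorm (d j) 2 (volume.restrict (Ω : Set E')) ≠ ⊤ := fun j =>
    ((Ehrling.memLp_two_of_isTestFunctionOn (hd j) volume).restrict _).eLpNorm_ne_top
  have hC2 : C ^ (1 / 2 : ℝ) ≠ ⊤ := (ENNReal.rpow_lt_top_of_nonneg (by norm_num) hC).ne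
  have hB : ∀ k j, ∀ᵐ t ∂(volume.restrict (Ioo a b)), ‖∫ x in (Ω : Set E'), d j x • v k t x‖ ≤
      (eLpNorm (d j) 2 (volume.restrict (Ω : Set E')) * C ^ (1 / 2 : ℝ)).toReal := by
    intro k j
    filter_upwards [hvs k, hvE k] with t hvt hEt
    rw [← toReal_enorm]
    refine ENNReal.toReal_mono (ENNReal.mul_ne_top (hKt j) hC2) ?_
    refine (Ehrling.enorm_integral_smul_le (hd j).contDiff.continuous.aestronglyMeasurable hvt).trans
      (mul_le_mul' le_rfl ?_)
    rw [AubinLions.eLpNorm_two_eq_rpow]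
    exact ENNReal.rpow_le_rpow hEt (by norm_num)
  -- extraction
  obtain ⟨σ, hσ, hconv⟩ := AubinLions.exists_subseq_ae_tendsto_of_equicontinuous
    (g := fun k j t => ∫ x in (Ω : Set E'), d j x • v k t x) hω hB
    fun k j => ⟨S j k, hSae j k, hS j k⟩
  -- the subsequence satisfies all hypotheses of the strong compactness theorem
  have hP := AubinLions.ae_tendsto_pairing_of_dense (v := fun i => v (σ i)) hbΩ hC
    (fun i => hvm (σ i)) (fun i => hvE (σ i)) hd hdense hconv
  obtain ⟨u, hum, huE, hus, huP⟩ := AubinLions.exists_strong_limit (v := fun i => v (σ i))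
    (G := fun i => G (σ i)) hΩ hbΩ hC hCg (fun i => hvm (σ i)) (fun i => hvE (σ i))
    (fun i => hGm (σ i)) (fun i => hG (σ i)) (fun i => hGb (σ i)) hP
  exact ⟨σ, u, hσ, hum, huE, hus, huP⟩

end Pairings

end Literature.Analysis.FunctionSpaces
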